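import Literature.AlgebraicGeometry.Motives.TateConjectureAllCodimensionsFullyAlgebraicFactor
import HarnessLib

/-!
# Tate's theorem, forms (a) and (c), along a factor with fully algebraic cohomology:
# `T′ᶜ ∧ Eᶜ` on `X × Z` iff on the pieces of `X`; «order of the pole of `Z(X × Z, T)` at `q^{−c}` = rank»
# iff «order of the pole of `Z(X, T)` at `q^{−p}` = rank» for every `p + q = c` with `b_{2q}(Z) ≠ 0`

Topic `Literature/AlgebraicGeometry/Motives`; THEOREMS ONLY (no definition, no instance, no named fact;
D-0026).

Tate's Th. 2.9 (Milne 2007 Th. 1.2, Kahn 2020 Th. 6.53): for `X` smooth projective of dimension `d` over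
`𝔽_q` and `r + s = d`, `(a) T′ʳ ∧ Eʳ ⟺ (b) T′ʳ ∧ T′ˢ ∧ Sʳ ⟺ (c) ord_{t=q^{−r}} Z(X, t) = ρ_r` (the tree:
`tate_a_iff_b`, `hasPoleOfOrderAt_zetaSeries_rank_iff`, `rank_eq_finrank_maxGenEigenspace_iff`).  Rows
g53-#6, #7, #10 moved `T′`, `E` and (b) between `X` and `X × Z` for a factor `Z` with `K·A^q(Z) = H^{2q}(Z)`
for all `q` and `b_{odd}(Z) = 0`.  Here the remaining two forms, codimension by codimension:

* §1 (`k` finite) **(a) for `X × Z` at `(c, c′)` iff (a) for `X` at every `(p, p′)`, `p + q = c`,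
  `p + p′ = n`, `H^{2q}(Z) ≠ 0`** (`tate_a_tensor_iff`; `T′` by row g53-#6, `E` by row g53-#7 with the
  passage `ℚ`-classes ↔ `K`-spans), and the same for the algebraic form of (c), **`ρ_c(X × Z) =
  dim H^{2c}(X × Z)(c)_1 ⟺ ρ_p(X) = dim H^{2p}(X)(p)_1` on those pieces** (`rank_eq_finrank_maxGenEigenspace_tensor_iff`).
* §2 (trace formula, `χ(φ_arith) = q`, RH for `X` and `Z`) **«`Z(X × Z, T)` has a pole of order exactly
  `ρ_c(X × Z)` at `q^{−c}`» iff «`Z(X, T)` has a pole of order exactly `ρ_p(X)` at `q^{−p}`» for every such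
  piece** (`hasPoleOfOrderAt_zetaSeries_rank_tensor_iff`), and for all codimensions at once
  (`forall_hasPoleOfOrderAt_zetaSeries_rank_tensor_iff`); `Z = 𝐏ʳ`
  (`hasPoleOfOrderAt_zetaSeries_rank_tensor_projectiveSpace_iff`).

HC is not touched; Tate's conjecture stays open — only equivalences between its instances are proved.

## References

* [Tate1994] J. Tate, *Conjectures on algebraic cycles in ℓ-adic cohomology* (1994), §2 Th. 2.9.
* [TateWoodsHole1965] J. Tate, *Algebraic cycles and poles of zeta functions* (1965), §3 (12)–(13).
* [Milne2007TateFiniteFieldsAIM] J. S. Milne, *The Tate conjecture over finite fields (AIM talk)*,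
  arXiv:0709.3040, §1 Th. 1.2, §2 Cor. 2.2.
* [Kahn2020] B. Kahn, *Zeta and L-Functions of Varieties and Motives* (2020), §6.4 Prop. 6.11–6.12,
  §6.14 Conj. 6.52, Th. 6.53.
* [Kleiman1968AlgebraicCycles] S. Kleiman, *Algebraic cycles and the Weil conjectures* (1968), §1.2, §3.
* [Hartshorne1977] R. Hartshorne, *Algebraic Geometry* (1977), App. C Ex. 5.2.
* Tree: rows g53-#6 (`algebraicClasses_eq_ker_sub_one_tensor_iff`), #7 (`homNum_of_homNum_tensor`,
  `homNum_tensor_of_forall`), #10 (`forall_tate_a_tensor_iff`); `TateConjectureStrongFormFiniteField`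
  (`homNum_iff_algebraicClasses`, `rank_eq_finrank_maxGenEigenspace_iff`), `ZetaFunctionPoleOrderTateConjecture`
  (`hasPoleOfOrderAt_zetaSeries_rank_iff`), `FrobeniusCharpolyKunnethProducts` (`weilRiemannHypothesisFor_tensor`).

## Provenance

Lane `lit-hodgefound` (summit `HodgeConjecture`, Track 2 foundations library, Layer B: motives — Tate's
theorem for products), seat `lit-hodgefound-p29` (literature-prover, generation 53, row g53-#11).
-/

universe u v

open CategoryTheory AlgebraicGeometry MonoidalCategory CartesianMonoidalCategory
open Literature.AlgebraicGeometry.Kahn2003 (HasPoleOfOrderAt)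

namespace Literature.AlgebraicGeometry.Motives

namespace GaloisWeilCohomology

variable {k : Type u} [Field k] [Finite k] {K : Type v} [Field K] [CharZero K]
  {χ : Field.absoluteGaloisGroup k →* Kˣ} (E : GaloisWeilCohomology k K χ)
variable {n m : ℕ} {X Z : SchemeOver k}

/-! ### §1 Tate's (a) and the algebraic form of (c), codimension by codimension -/

/-- **Tate's condition (a) `T′ᶜ ∧ Eᶜ` for `X × Z` at `(c, c′)` iff `T′ᵖ ∧ Eᵖ` for `X` at every `(p, p′)` with
`p + q = c`, `p + p′ = n`, `H^{2q}(Z) ≠ 0`** (`Z` with fully algebraic cohomology; `c + c′ = n + m`).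
[cite: Tate1994, §2 Th. 2.9 (a)] [cite: Milne2007TateFiniteFieldsAIM, Th. 1.2 and Cor. 2.2] [cite: Kahn2020, §6.4 Prop. 6.11–6.12] -/
theorem tate_a_tensor_iff (hX : IsSmoothProjective n X) (hZ : IsSmoothProjective m Z)
    (hZalg : ∀ q, E.algebraicClasses Z q = ⊤) (hZodd : ∀ j, Odd j → Module.finrank K (E.obj Z j) = 0)
    {c c' : ℕ} (hcc' : c + c' = n + m) (h : 2 * c + 2 * c' = 2 * (n + m)) :
    (E.algebraicClasses (X ⊗ Z) c = LinearMap.ker (E.ρTwist (X ⊗ Z) (2 * c) c (geomFrob k) - 1) ∧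
      ∀ x ∈ E.ratAlgebraicClasses (X ⊗ Z) c, (∀ y ∈ E.ratAlgebraicClasses (X ⊗ Z) c',
        E.cupPairing (X ⊗ Z) (n + m) (2 * c) (2 * c') h x y = 0) → x = 0) ↔
      ∀ (p q p' : ℕ), p + q = c → ∀ (hp : 2 * p + 2 * p' = 2 * n), Nontrivial (E.obj Z (2 * q)) →
        E.algebraicClasses X p = LinearMap.ker (E.ρTwist X (2 * p) p (geomFrob k) - 1) ∧
          ∀ x ∈ E.ratAlgebraicClasses X p, (∀ y ∈ E.ratAlgebraicClasses X p',
            E.cupPairing X n (2 * p) (2 * p') hp x y = 0) → x = 0 := by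
  have hXZ := IsSmoothProjective.tensor_holds hX hZ
  rw [E.homNum_iff_algebraicClasses hXZ hcc' h]
  constructor
  · rintro ⟨hT, hE⟩ p q p' hpq hp hZq
    exact ⟨(E.algebraicClasses_eq_ker_sub_one_tensor_iff hX hZ hZalg hZodd (geomFrob k) c).mp hT p q hpq hZq,
      (E.homNum_iff_algebraicClasses hX (show p + p' = n by omega) hp).mpr
        (E.homNum_of_homNum_tensor hX hZ hZalg hpq (by omega) hcc' hZq h hp hE)⟩
  · intro ha
    refine ⟨(E.algebraicClasses_eq_ker_sub_one_tensor_iff hX hZ hZalg hZodd (geomFrob k) c).mpr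
        fun p q hpq hZq ↦ ?_,
      E.homNum_tensor_of_forall hX hZ hZalg hZodd hcc' h fun p q p' hpq hp hZq ↦
        (E.homNum_iff_algebraicClasses hX (show p + p' = n by omega) hp).mp (ha p q p' hpq hp hZq).2⟩
    rcases Nat.lt_or_ge n p with hpn | hpn
    · haveI := E.subsingleton_obj hX (i := 2 * p) (by omega)
      exact Subsingleton.elim _ _
    · exact (ha p q (n - p) hpq (by omega) hZq).1

/-- **`ρ_c(X × Z) = dim H^{2c}(X × Z)(c)_1` iff `ρ_p(X) = dim H^{2p}(X)(p)_1` for every `p + q = c`,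
`p + p′ = n` with `H^{2q}(Z) ≠ 0`** — the algebraic form of Tate's (c) («rank = multiplicity of the
eigenvalue `1` of `φ_c`»), through `(c) ⟺ (a)` on both sides (the tree's `rank_eq_finrank_maxGenEigenspace_iff`).
[cite: Tate1994, §2 Th. 2.9] [cite: Kahn2020, §6.14 Conj. 6.52 and Th. 6.53] -/
theorem rank_eq_finrank_maxGenEigenspace_tensor_iff (hX : IsSmoothProjective n X)
    (hZ : IsSmoothProjective m Z) (hZalg : ∀ q, E.algebraicClasses Z q = ⊤)
    (hZodd : ∀ j, Odd j → Module.finrank K (E.obj Z j) = 0) {c c' : ℕ} (hcc' : c + c' = n + m)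
    (h : 2 * c + 2 * c' = 2 * (n + m)) :
    Module.finrank K (LinearMap.range ((E.cupPairing (X ⊗ Z) (n + m) (2 * c) (2 * c') h).domRestrict₁₂
          (E.algebraicClasses (X ⊗ Z) c) (E.algebraicClasses (X ⊗ Z) c'))) =
        Module.finrank K (Module.End.maxGenEigenspace (E.ρTwist (X ⊗ Z) (2 * c) c (geomFrob k)) 1) ↔
      ∀ (p q p' : ℕ), p + q = c → ∀ (hp : 2 * p + 2 * p' = 2 * n), Nontrivial (E.obj Z (2 * q)) →
        Module.finrank K (LinearMap.range ((E.cupPairing X n (2 * p) (2 * p') hp).domRestrict₁₂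
            (E.algebraicClasses X p) (E.algebraicClasses X p'))) =
          Module.finrank K (Module.End.maxGenEigenspace (E.ρTwist X (2 * p) p (geomFrob k)) 1) := by
  rw [E.rank_eq_finrank_maxGenEigenspace_iff (IsSmoothProjective.tensor_holds hX hZ) hcc' h,
    E.tate_a_tensor_iff hX hZ hZalg hZodd hcc' h]
  refine forall₄_congr fun p q p' hpq ↦ forall₂_congr fun hp _ ↦ ?_
  rw [E.rank_eq_finrank_maxGenEigenspace_iff hX (show p + p' = n by omega) hp]

/-! ### §2 «Order of the pole = rank» -/

/-- **«`ord_{q^{−c}} Z(X × Z, T) = ρ_c(X × Z)`» iff «`ord_{q^{−p}} Z(X, T) = ρ_p(X)`» for every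
`p + q = c`, `p + p′ = n` with `b_{2q}(Z) ≠ 0`** — Tate's (c) for `X × Z` at `c` versus for `X` on the pieces
(trace formula, `χ(φ_arith) = q`, RH for `X` and `Z`; `Z` with fully algebraic cohomology).
[cite: Tate1994, §2 Th. 2.9 (c)] [cite: TateWoodsHole1965, §3 (12)–(13)] [cite: Milne2007TateFiniteFieldsAIM, Th. 1.2 and Cor. 2.2]
[cite: Kahn2020, §6.14 Conj. 6.52 and Th. 6.53] -/
theorem hasPoleOfOrderAt_zetaSeries_rank_tensor_iff (hE : E.HasLefschetzTraceFormula)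
    (hχ : ((χ (arithFrob k) : Kˣ) : K) = Nat.card k) (hX : IsSmoothProjective n X)
    (hZ : IsSmoothProjective m Z) (hZalg : ∀ q, E.algebraicClasses Z q = ⊤)
    (hZodd : ∀ j, Odd j → Module.finrank K (E.obj Z j) = 0) (hRHX : E.WeilRiemannHypothesisFor X n)
    (hRHZ : E.WeilRiemannHypothesisFor Z m) {c c' : ℕ} (hcc' : c + c' = n + m)
    (h : 2 * c + 2 * c' = 2 * (n + m)) :
    HasPoleOfOrderAt (zetaSeries (X ⊗ Z)) (((Nat.card k : ℚ) ^ c)⁻¹)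
        (Module.finrank K (LinearMap.range ((E.cupPairing (X ⊗ Z) (n + m) (2 * c) (2 * c') h).domRestrict₁₂
          (E.algebraicClasses (X ⊗ Z) c) (E.algebraicClasses (X ⊗ Z) c')))) ↔
      ∀ (p q p' : ℕ), p + q = c → ∀ (hp : 2 * p + 2 * p' = 2 * n), Nontrivial (E.obj Z (2 * q)) →
        HasPoleOfOrderAt (zetaSeries X) (((Nat.card k : ℚ) ^ p)⁻¹)
          (Module.finrank K (LinearMap.range ((E.cupPairing X n (2 * p) (2 * p') hp).domRestrict₁₂
            (E.algebraicClasses X p) (E.algebraicClasses X p')))) := by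
  rw [E.hasPoleOfOrderAt_zetaSeries_rank_iff hE hχ (IsSmoothProjective.tensor_holds hX hZ)
    (E.weilRiemannHypothesisFor_tensor hX hZ hRHX hRHZ) hcc' h, E.tate_a_tensor_iff hX hZ hZalg hZodd hcc' h]
  refine forall₄_congr fun p q p' hpq ↦ forall₂_congr fun hp _ ↦ ?_
  rw [E.hasPoleOfOrderAt_zetaSeries_rank_iff hE hχ hX hRHX (show p + p' = n by omega) hp]

/-- **All codimensions: «order of the pole = rank» holds for `Z(X × Z, T)` at every `q^{−c}`, `c + c′ = n + m`,
iff it holds for `Z(X, T)` at every `q^{−r}`, `r + s = n`** (row g53-#10's `forall_tate_a_tensor_iff` read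
through `(c) ⟺ (a)`). [cite: Tate1994, §2 Th. 2.9] [cite: TateWoodsHole1965, §3 (12)–(13)] [cite: Kahn2020, §6.14 Th. 6.53] -/
theorem forall_hasPoleOfOrderAt_zetaSeries_rank_tensor_iff (hE : E.HasLefschetzTraceFormula)
    (hχ : ((χ (arithFrob k) : Kˣ) : K) = Nat.card k) (hX : IsSmoothProjective n X)
    (hZ : IsSmoothProjective m Z) (hZalg : ∀ q, E.algebraicClasses Z q = ⊤)
    (hZodd : ∀ j, Odd j → Module.finrank K (E.obj Z j) = 0) (hRHX : E.WeilRiemannHypothesisFor X n)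
    (hRHZ : E.WeilRiemannHypothesisFor Z m) :
    (∀ (c c' : ℕ) (hcc' : c + c' = n + m),
      HasPoleOfOrderAt (zetaSeries (X ⊗ Z)) (((Nat.card k : ℚ) ^ c)⁻¹)
        (Module.finrank K (LinearMap.range ((E.cupPairing (X ⊗ Z) (n + m) (2 * c) (2 * c')
          (by omega)).domRestrict₁₂ (E.algebraicClasses (X ⊗ Z) c) (E.algebraicClasses (X ⊗ Z) c'))))) ↔
      ∀ (r s : ℕ) (hrs : r + s = n),
        HasPoleOfOrderAt (zetaSeries X) (((Nat.card k : ℚ) ^ r)⁻¹)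
          (Module.finrank K (LinearMap.range ((E.cupPairing X n (2 * r) (2 * s) (by omega)).domRestrict₁₂
            (E.algebraicClasses X r) (E.algebraicClasses X s)))) := by
  have hXZ := IsSmoothProjective.tensor_holds hX hZ
  have hRH := E.weilRiemannHypothesisFor_tensor hX hZ hRHX hRHZ
  refine Iff.trans (forall₃_congr fun c c' hcc' ↦ E.hasPoleOfOrderAt_zetaSeries_rank_iff hE hχ hXZ hRH hcc' _)
    (Iff.trans (E.forall_tate_a_tensor_iff hX hZ hZalg hZodd)
      (forall₃_congr fun r s hrs ↦ (E.hasPoleOfOrderAt_zetaSeries_rank_iff hE hχ hX hRHX hrs _).symm))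

/-! ### `Z = 𝐏ʳ` -/

/-- **«`ord_{q^{−c}} Z(X × 𝐏ʳ, T) = ρ_c(X × 𝐏ʳ)`» iff «`ord_{q^{−p}} Z(X, T) = ρ_p(X)`» for every
`c − r ≤ p ≤ c`, `p ≤ n`** (trace formula, `χ(φ_arith) = q`, RH for `X` and `𝐏ʳ`).
[cite: Milne2007TateFiniteFieldsAIM, Th. 1.2 and Cor. 2.2] [cite: Tate1994, §2 Th. 2.9] [cite: Hartshorne1977, App. C Ex. 5.2] -/
theorem hasPoleOfOrderAt_zetaSeries_rank_tensor_projectiveSpace_iff (hE : E.HasLefschetzTraceFormula)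
    (hχ : ((χ (arithFrob k) : Kˣ) : K) = Nat.card k) {r : ℕ}
    (hRH : E.WeilRiemannHypothesisFor (projectiveSpace r k) r) (hX : IsSmoothProjective n X)
    (hRHX : E.WeilRiemannHypothesisFor X n) {c c' : ℕ} (hcc' : c + c' = n + r)
    (h : 2 * c + 2 * c' = 2 * (n + r)) :
    HasPoleOfOrderAt (zetaSeries (X ⊗ projectiveSpace r k)) (((Nat.card k : ℚ) ^ c)⁻¹)
        (Module.finrank K (LinearMap.range ((E.cupPairing (X ⊗ projectiveSpace r k) (n + r) (2 * c) (2 * c')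
          h).domRestrict₁₂ (E.algebraicClasses (X ⊗ projectiveSpace r k) c)
            (E.algebraicClasses (X ⊗ projectiveSpace r k) c')))) ↔
      ∀ (p q p' : ℕ), p + q = c → ∀ (hp : 2 * p + 2 * p' = 2 * n), q ≤ r →
        HasPoleOfOrderAt (zetaSeries X) (((Nat.card k : ℚ) ^ p)⁻¹)
          (Module.finrank K (LinearMap.range ((E.cupPairing X n (2 * p) (2 * p') hp).domRestrict₁₂
            (E.algebraicClasses X p) (E.algebraicClasses X p')))) := by
  rw [E.hasPoleOfOrderAt_zetaSeries_rank_tensor_iff hE hχ hX (isSmoothProjective_projectiveSpace_holds k r)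
    (E.algebraicClasses_projectiveSpace_eq_top hE hχ hRH) (fun _ hj ↦ E.finrank_projectiveSpace_of_odd hE hχ hRH hj)
    hRHX hRH hcc' h]
  refine forall₄_congr fun p q p' hpq ↦ forall_congr' fun hp ↦ ?_
  rw [E.nontrivial_projectiveSpace_iff hE hχ hRH]

end GaloisWeilCohomology

end Literature.AlgebraicGeometry.Motives
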